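import Mathlib
import Literature.Geometry.DiscreteGeometry.KissingPatterns
import Literature.MathematicalPhysics.StatisticalMechanics.LennardJonesClusters

/-!
# Route ReggeStarCoercivity — crux `StarCoercivity` (stmt-AtomisticToContinuum-13600), line
# `elastic-tier-overlap-split`, stub S2g `stub_elasticTierGlue`: reduction of the near tier S2 to the
# REGIONAL coercivity inequality S2a `stub_regionalEngine` (collar bookkeeping)

The near (elastic) tier S2 of the line is the global inequality, for `1/3`-separated `x : Fin N → ℝ³`,
`N·e_per + κ·#Def₁⁄₂₀(x) − C_b·#Def₁⁄₁₅(x) − C·N^(2/3) ≤ E_LJ(x)` (`κ > 0`; `C_b`, `C` free).  Its content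
is elastic: it lives on the region `Ω_R(x)` of sites ALL of whose `R`-neighbours are `1/15`-close to a Barlow
shell, where the configuration is a strained close-packed stacking.  This file proves, unconditionally,
that S2 follows from the REGIONAL ENGINE inequality

  `κ·#(Ω_R ∩ Def) − C_f·#{¬ Good} ≤ Σ_{i ∈ Ω_R} (½·𝓔ⁱ(x) − e_per)`      (all `1/3`-separated `x`)

(`Good = 1/15-close`, `Def = 1/20-defective`: `elasticTier_of_regionalEngine`, whose conclusion is verbatim
the registered signature of the stub; the per-configuration step `tier_step` is stated for arbitrary index
sets), with `C_b = K_R·(|e_per| + κ + 30375/2) + C_f`, `K_R = (6R + 1)³`, `C = 0`.  Ingredients, all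
elementary on `1/3`-separated configurations: `E_LJ = ½ Σ_i 𝓔ⁱ` (`two_mul_interactionEnergy`); the
site-energy floor `½ 𝓔ⁱ ≥ −30375/2` (`V_LJ ≥ −r⁻⁶/6` and the shell sum `Σ r⁻⁶ ≤ 250·3⁶`,
`sum_inv_pow_six_le`); the packing count "at most `(6R+1)³` sites within `R` of a point"
(`card_le_of_separated_of_dist_le`), whence the collar bounds `#Ω_Rᶜ ≤ K_R·#{¬ Good}` (`card_near_le`)
and, for the engine's own boundary term, `#{i ∈ Ω_R : some j ∉ Ω_R within ρ} ≤ K_{R+ρ}·#{¬ Good}`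
(`card_boundary_le`).  No value or sign of `e_per` is used (`|e_per|` enters `C_b`).  What is NOT here is
the engine itself (harmonic coercivity of the Barlow stackings under the 12-6 potential with its tail, a
robust layer lemma at tolerance `1/15`, the equation-of-state rung): that is the open content of the stub.
-/

noncomputable section

open scoped Classical BigOperators

namespace Summit.AtomisticToContinuum.Crystallization.Theorems.ElasticTierOverlapSplit

open Literature.MathematicalPhysics.StatisticalMechanics Literature.Geometry.DiscreteGeometry

/-! ## Counting on `1/3`-separated configurations -/

/-- A `1/3`-separated configuration is injective. -/
theorem injective_of_separated {N : ℕ} {x : Fin N → EuclideanSpace ℝ (Fin 3)}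
    (hx : ∀ i j : Fin N, i ≠ j → (1 / 3 : ℝ) ≤ dist (x i) (x j)) : Function.Injective x := by
  intro i j h
  by_contra hij
  have h1 := hx i j hij
  rw [h, dist_self] at h1
  norm_num at h1

/-- **Packing count.** In a `1/3`-separated configuration at most `(6R + 1)³` particles lie within
distance `R` of any point of `ℝ³` (disjoint balls of radius `1/6`; `card_le_of_separated_of_dist_le`). -/
theorem card_filter_dist_le {N : ℕ} {x : Fin N → EuclideanSpace ℝ (Fin 3)}
    (hx : ∀ i j : Fin N, i ≠ j → (1 / 3 : ℝ) ≤ dist (x i) (x j)) (p : EuclideanSpace ℝ (Fin 3)) {R : ℝ} (hR : 0 ≤ R) :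
    ((Finset.univ.filter fun j : Fin N => dist (x j) p ≤ R).card : ℝ) ≤ (6 * R + 1) ^ 3 := by
  set S := Finset.univ.filter fun j : Fin N => dist (x j) p ≤ R with hS
  have hinj := injective_of_separated hx
  have hcard : (S.image x).card = S.card := Finset.card_image_of_injective _ hinj
  have h := card_le_of_separated_of_dist_le (S.image x) p (r := 1 / 3) (R := R) (by norm_num) hR
    (fun c hc => by
      obtain ⟨j, hj, rfl⟩ := Finset.mem_image.1 hc
      exact (Finset.mem_filter.1 hj).2)
    (fun c hc d hd hcd => by
      obtain ⟨j, -, rfl⟩ := Finset.mem_image.1 hc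
      obtain ⟨k, -, rfl⟩ := Finset.mem_image.1 hd
      exact hx j k fun h => hcd (congrArg x h))
  rw [hcard, finrank_euclideanSpace_fin] at h
  have h6 : (2 * R / (1 / 3) + 1 : ℝ) = 6 * R + 1 := by ring
  rw [h6] at h
  exact h

/-- **Collar count.** In a `1/3`-separated configuration, a set `T` of particles each of which has a
particle of `B` within distance `R` has at most `(6R + 1)³ · #B` elements. -/
theorem card_near_le {N : ℕ} {x : Fin N → EuclideanSpace ℝ (Fin 3)}
    (hx : ∀ i j : Fin N, i ≠ j → (1 / 3 : ℝ) ≤ dist (x i) (x j)) {R : ℝ} (hR : 0 ≤ R)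
    {T B : Finset (Fin N)} (hT : ∀ i ∈ T, ∃ j ∈ B, dist (x i) (x j) ≤ R) :
    (T.card : ℝ) ≤ (6 * R + 1) ^ 3 * (B.card : ℝ) := by
  have hsub : T ⊆ B.biUnion fun j => Finset.univ.filter fun i : Fin N => dist (x i) (x j) ≤ R := by
    intro i hi
    obtain ⟨j, hj, hd⟩ := hT i hi
    exact Finset.mem_biUnion.2 ⟨j, hj, Finset.mem_filter.2 ⟨Finset.mem_univ _, hd⟩⟩
  calc (T.card : ℝ)
      ≤ ((B.biUnion fun j => Finset.univ.filter fun i : Fin N => dist (x i) (x j) ≤ R).card : ℝ) := by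
        exact_mod_cast Finset.card_le_card hsub
    _ ≤ ∑ j ∈ B, ((Finset.univ.filter fun i : Fin N => dist (x i) (x j) ≤ R).card : ℝ) := by
        exact_mod_cast Finset.card_biUnion_le
    _ ≤ ∑ j ∈ B, ((6 * R + 1) ^ 3 : ℝ) := Finset.sum_le_sum fun j _ => card_filter_dist_le hx (x j) hR
    _ = (6 * R + 1) ^ 3 * (B.card : ℝ) := by rw [Finset.sum_const, nsmul_eq_mul, mul_comm]

/-- **Boundary collar count** (how a boundary term `C_f·#∂_ρΩ` of a regional inequality is charged to the
gross sites).  If every index outside `Ω` has an index of `B` within `R`, then a set `T` of indices each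
having an index outside `Ω` within `ρ` (e.g. the `ρ`-boundary layer of `Ω`) has at most
`(6(R + ρ) + 1)³ · #B` elements. -/
theorem card_boundary_le {N : ℕ} {x : Fin N → EuclideanSpace ℝ (Fin 3)}
    (hx : ∀ i j : Fin N, i ≠ j → (1 / 3 : ℝ) ≤ dist (x i) (x j)) {R ρ : ℝ} (hR : 0 ≤ R) (hρ : 0 ≤ ρ)
    {Ω T B : Finset (Fin N)} (hΩ : ∀ j, j ∉ Ω → ∃ g ∈ B, dist (x j) (x g) ≤ R)
    (hT : ∀ i ∈ T, ∃ j, j ∉ Ω ∧ dist (x i) (x j) ≤ ρ) :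
    (T.card : ℝ) ≤ (6 * (R + ρ) + 1) ^ 3 * (B.card : ℝ) := by
  refine card_near_le hx (by positivity) fun i hi => ?_
  obtain ⟨j, hj, hd⟩ := hT i hi
  obtain ⟨g, hg, hd'⟩ := hΩ j hj
  exact ⟨g, hg, (dist_triangle (x i) (x j) (x g)).trans (by linarith)⟩

/-! ## The site-energy floor -/

/-- **Site-energy floor.** On a `1/3`-separated configuration every half site energy is at least
`−30375/2` (`V_LJ(r) ≥ −r⁻⁶/6`, `Σ_{k ≠ i} |xᵢ − x_k|⁻⁶ ≤ 250·3⁶ = 182250`). -/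
theorem half_siteSum_ge {N : ℕ} {x : Fin N → EuclideanSpace ℝ (Fin 3)}
    (hx : ∀ i j : Fin N, i ≠ j → (1 / 3 : ℝ) ≤ dist (x i) (x j)) (i : Fin N) :
    -(30375 / 2 : ℝ) ≤ (1 / 2 : ℝ) * ∑ j ∈ Finset.univ.erase i, lennardJones (dist (x i) (x j)) := by
  have h6 := sum_inv_pow_six_le x (r := 1 / 3) (by norm_num) hx i
  have hV : ∀ r : ℝ, -(1 / 6) * r⁻¹ ^ 6 ≤ lennardJones r := fun r => by
    unfold lennardJones
    have : 0 ≤ (1 / 12 : ℝ) * r⁻¹ ^ 12 := by positivity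
    linarith
  have hsum : -(1 / 6) * ∑ j ∈ Finset.univ.erase i, (dist (x i) (x j))⁻¹ ^ 6 ≤
      ∑ j ∈ Finset.univ.erase i, lennardJones (dist (x i) (x j)) := by
    rw [Finset.mul_sum]
    exact Finset.sum_le_sum fun j _ => hV _
  have h729 : (1 / 3 : ℝ)⁻¹ ^ 6 = 729 := by norm_num
  rw [h729] at h6
  linarith

/-! ## The reduction: regional engine ⇒ global tier -/

/-- **Collar bookkeeping, one configuration.** Let `x` be `1/3`-separated, `κ ≥ 0`, `R ≥ 0`, `C_f`, `e`
reals, and `Ω, Ω_D, D, B` sets of indices such that every index outside `Ω` has an index of `B` within `R`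
(`B` = the gross sites, `Ω` ⊇ the sites with no gross `R`-neighbour) and `D ∩ Ω ⊆ Ω_D`.  If the REGIONAL
inequality `κ·#Ω_D − C_f·#B ≤ Σ_{i ∈ Ω} (½ Σ_{j ≠ i} V_LJ(|xᵢ − xⱼ|) − e)` holds, then the GLOBAL one
`N·e + κ·#D − ((6R+1)³·(|e| + κ + 30375/2) + C_f)·#B ≤ E_LJ(x)` holds.  Proof: `E_LJ = ½Σ_Ω + ½Σ_{Ωᶜ}`
(`two_mul_interactionEnergy`); on `Ωᶜ` the site-energy floor `−30375/2`; `#Ωᶜ ≤ (6R+1)³·#B`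
(`card_near_le`); `#D ≤ #Ω_D + #Ωᶜ`; `#Ω·e = N·e − #Ωᶜ·e ≥ N·e − #Ωᶜ·|e|`.  No property of `e` is used. -/
theorem tier_step {N : ℕ} (x : Fin N → EuclideanSpace ℝ (Fin 3))
    (hx : ∀ i j : Fin N, i ≠ j → (1 / 3 : ℝ) ≤ dist (x i) (x j)) {κ R Cf e : ℝ} (hκ : 0 ≤ κ)
    (hR : 0 ≤ R) {Ω ΩD D B : Finset (Fin N)}
    (hΩ : ∀ i, i ∉ Ω → ∃ j ∈ B, dist (x i) (x j) ≤ R)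
    (hD : ∀ i ∈ D, i ∈ Ω → i ∈ ΩD)
    (hre : κ * (ΩD.card : ℝ) - Cf * (B.card : ℝ) ≤
      ∑ i ∈ Ω, ((1 / 2 : ℝ) * (∑ j ∈ Finset.univ.erase i, lennardJones (dist (x i) (x j))) - e)) :
    (N : ℝ) * e + κ * (D.card : ℝ) - ((6 * R + 1) ^ 3 * (|e| + κ + 30375 / 2) + Cf) * (B.card : ℝ) ≤
      interactionEnergy lennardJones x := by
  set K : ℝ := (6 * R + 1) ^ 3 with hK
  have hK0 : 0 ≤ K := by positivity
  set s : Fin N → ℝ := fun i => ∑ j ∈ Finset.univ.erase i, lennardJones (dist (x i) (x j)) with hs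
  -- (1) the complement of the region is within `R` of `B`
  have hΩc_le : ((Ωᶜ).card : ℝ) ≤ K * (B.card : ℝ) :=
    card_near_le hx hR fun i hi => hΩ i (Finset.mem_compl.1 hi)
  -- (2) every site of `D` is in `Ω_D` or outside `Ω`
  have hD_le : (D.card : ℝ) ≤ (ΩD.card : ℝ) + ((Ωᶜ).card : ℝ) := by
    have hsub : D ⊆ ΩD ∪ Ωᶜ := by
      intro i hi
      by_cases hiΩ : i ∈ Ω
      · exact Finset.mem_union_left _ (hD i hi hiΩ)
      · exact Finset.mem_union_right _ (Finset.mem_compl.2 hiΩ)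
    have := (Finset.card_le_card hsub).trans (Finset.card_union_le _ _)
    exact_mod_cast this
  -- (3) the two parts of the index set
  have hcardN : (Ω.card : ℝ) + ((Ωᶜ).card : ℝ) = N := by
    have h := Finset.card_add_card_compl Ω
    rw [Fintype.card_fin] at h
    exact_mod_cast h
  -- (4) the energy splits accordingly
  have hE : 2 * interactionEnergy lennardJones x = ∑ i ∈ Ω, s i + ∑ i ∈ Ωᶜ, s i := by
    rw [two_mul_interactionEnergy]
    exact (Finset.sum_add_sum_compl Ω s).symm
  -- (5) the site-energy floor on the complement
  have hfloor : ((Ωᶜ).card : ℝ) * (-(30375 / 2 : ℝ)) ≤ ∑ i ∈ Ωᶜ, (1 / 2 : ℝ) * s i := by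
    have := Finset.card_nsmul_le_sum Ωᶜ (fun i => (1 / 2 : ℝ) * s i) (-(30375 / 2 : ℝ))
      (fun i _ => half_siteSum_ge hx i)
    rwa [nsmul_eq_mul] at this
  have hsumΩ : ∑ i ∈ Ω, ((1 / 2 : ℝ) * s i - e) = (1 / 2) * ∑ i ∈ Ω, s i - Ω.card * e := by
    rw [Finset.sum_sub_distrib, Finset.sum_const, nsmul_eq_mul, Finset.mul_sum]
  have hsumΩc : ∑ i ∈ Ωᶜ, (1 / 2 : ℝ) * s i = (1 / 2) * ∑ i ∈ Ωᶜ, s i := by rw [Finset.mul_sum]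
  have hreg : κ * (ΩD.card : ℝ) - Cf * (B.card : ℝ) ≤ ∑ i ∈ Ω, ((1 / 2 : ℝ) * s i - e) := hre
  -- (6) linear bookkeeping
  have hB0 : (0 : ℝ) ≤ B.card := Nat.cast_nonneg _
  have hΩc0 : (0 : ℝ) ≤ (Ωᶜ).card := Nat.cast_nonneg _
  have hp1 : ((Ωᶜ).card : ℝ) * e ≤ ((Ωᶜ).card : ℝ) * |e| :=
    mul_le_mul_of_nonneg_left (le_abs_self _) hΩc0
  have hp2 : ((Ωᶜ).card : ℝ) * (|e| + κ + 30375 / 2) ≤ K * (B.card : ℝ) * (|e| + κ + 30375 / 2) :=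
    mul_le_mul_of_nonneg_right hΩc_le (by positivity)
  have hp3 : κ * (D.card : ℝ) ≤ κ * ((ΩD.card : ℝ) + ((Ωᶜ).card : ℝ)) :=
    mul_le_mul_of_nonneg_left hD_le hκ
  have hp4 : (Ω.card : ℝ) * e = N * e - (Ωᶜ).card * e := by rw [← hcardN]; ring
  linarith [hreg, hE, hfloor, hsumΩ, hsumΩc, hp1, hp2, hp3, hp4]

/-- **S2 from the regional engine, in the crux's own vocabulary.** If for some `κ > 0`, `R ≥ 0`, `C_f` every
`1/3`-separated configuration satisfies, on the region `Ω_R` of sites all of whose `R`-neighbours are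
`1/15`-close to a Barlow shell (some dilation `a ∈ [9/10, 11/10]` makes the recentred rescaled `6/5`-shell
`1/15`-matched after a linear isometry to the fcc or hcp kissing pattern),
`κ·#(Ω_R ∩ Def₁⁄₂₀) − C_f·#Def₁⁄₁₅ ≤ Σ_{i ∈ Ω_R} (½ 𝓔ⁱ − e_per)`,
then the near tier holds — the conclusion is verbatim the registered signature of `stub_elasticTier`. -/
theorem elasticTier_of_regionalEngine
    (h : ∃ κ : ℝ, 0 < κ ∧ ∃ R Cf : ℝ, 0 ≤ R ∧ ∀ (N : ℕ) (x : Fin N → EuclideanSpace ℝ (Fin 3)),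
      (∀ i j : Fin N, i ≠ j → (1 / 3 : ℝ) ≤ dist (x i) (x j)) →
      κ * ((Finset.univ.filter fun i : Fin N =>
              (∀ j : Fin N, dist (x j) (x i) ≤ R → ∃ a : ℝ, 9 / 10 ≤ a ∧ a ≤ 11 / 10 ∧
                (ShellCloseTo (1 / 15) ((Finset.univ.filter fun k : Fin N => k ≠ j ∧ dist (x j) (x k) ≤ 6 / 5).image
                    fun k => a⁻¹ • (x k - x j)) fccKissingPattern ∨
                  ShellCloseTo (1 / 15) ((Finset.univ.filter fun k : Fin N => k ≠ j ∧ dist (x j) (x k) ≤ 6 / 5).image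
                    fun k => a⁻¹ • (x k - x j)) hcpKissingPattern)) ∧
              ¬ ∃ a : ℝ, 9 / 10 ≤ a ∧ a ≤ 11 / 10 ∧
                (ShellCloseTo (1 / 20) ((Finset.univ.filter fun j : Fin N => j ≠ i ∧ dist (x i) (x j) ≤ 6 / 5).image
                    fun j => a⁻¹ • (x j - x i)) fccKissingPattern ∨
                  ShellCloseTo (1 / 20) ((Finset.univ.filter fun j : Fin N => j ≠ i ∧ dist (x i) (x j) ≤ 6 / 5).image
                    fun j => a⁻¹ • (x j - x i)) hcpKissingPattern)).card : ℝ)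
          - Cf * (Nat.card {i : Fin N // ¬ ∃ a : ℝ, 9 / 10 ≤ a ∧ a ≤ 11 / 10 ∧
              (ShellCloseTo (1 / 15) ((Finset.univ.filter fun j : Fin N => j ≠ i ∧ dist (x i) (x j) ≤ 6 / 5).image
                  fun j => a⁻¹ • (x j - x i)) fccKissingPattern ∨
                ShellCloseTo (1 / 15) ((Finset.univ.filter fun j : Fin N => j ≠ i ∧ dist (x i) (x j) ≤ 6 / 5).image
                  fun j => a⁻¹ • (x j - x i)) hcpKissingPattern)} : ℝ)
        ≤ ∑ i ∈ Finset.univ.filter (fun i : Fin N => ∀ j : Fin N, dist (x j) (x i) ≤ R →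
              ∃ a : ℝ, 9 / 10 ≤ a ∧ a ≤ 11 / 10 ∧
                (ShellCloseTo (1 / 15) ((Finset.univ.filter fun k : Fin N => k ≠ j ∧ dist (x j) (x k) ≤ 6 / 5).image
                    fun k => a⁻¹ • (x k - x j)) fccKissingPattern ∨
                  ShellCloseTo (1 / 15) ((Finset.univ.filter fun k : Fin N => k ≠ j ∧ dist (x j) (x k) ≤ 6 / 5).image
                    fun k => a⁻¹ • (x k - x j)) hcpKissingPattern)),
            ((1 / 2 : ℝ) * (∑ j ∈ Finset.univ.erase i, lennardJones (dist (x i) (x j)))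
              - ⨅ Q : PeriodicConfiguration 3, Q.energyPerParticle lennardJones)) :
    ∃ κ : ℝ, 0 < κ ∧ ∃ Cb C : ℝ, ∀ (N : ℕ) (x : Fin N → EuclideanSpace ℝ (Fin 3)),
      (∀ i j : Fin N, i ≠ j → (1 / 3 : ℝ) ≤ dist (x i) (x j)) →
      (N : ℝ) * (⨅ Q : PeriodicConfiguration 3, Q.energyPerParticle lennardJones)
          + κ * (Nat.card {i : Fin N // ¬ ∃ a : ℝ, 9 / 10 ≤ a ∧ a ≤ 11 / 10 ∧
              (ShellCloseTo (1 / 20) ((Finset.univ.filter fun j : Fin N => j ≠ i ∧ dist (x i) (x j) ≤ 6 / 5).image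
                  fun j => a⁻¹ • (x j - x i)) fccKissingPattern ∨
                ShellCloseTo (1 / 20) ((Finset.univ.filter fun j : Fin N => j ≠ i ∧ dist (x i) (x j) ≤ 6 / 5).image
                  fun j => a⁻¹ • (x j - x i)) hcpKissingPattern)} : ℝ)
          - Cb * (Nat.card {i : Fin N // ¬ ∃ a : ℝ, 9 / 10 ≤ a ∧ a ≤ 11 / 10 ∧
              (ShellCloseTo (1 / 15) ((Finset.univ.filter fun j : Fin N => j ≠ i ∧ dist (x i) (x j) ≤ 6 / 5).image
                  fun j => a⁻¹ • (x j - x i)) fccKissingPattern ∨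
                ShellCloseTo (1 / 15) ((Finset.univ.filter fun j : Fin N => j ≠ i ∧ dist (x i) (x j) ≤ 6 / 5).image
                  fun j => a⁻¹ • (x j - x i)) hcpKissingPattern)} : ℝ)
          - C * (N : ℝ) ^ (2 / 3 : ℝ) ≤ interactionEnergy lennardJones x := by
  obtain ⟨κ, hκ, R, Cf, hR, hre⟩ := h
  refine ⟨κ, hκ, (6 * R + 1) ^ 3 *
    (|⨅ Q : PeriodicConfiguration 3, Q.energyPerParticle lennardJones| + κ + 30375 / 2) + Cf, 0,
    fun N x hx => ?_⟩
  have hre' := hre N x hx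
  rw [Nat.card_eq_fintype_card, Fintype.card_subtype] at hre'
  rw [Nat.card_eq_fintype_card, Fintype.card_subtype, Nat.card_eq_fintype_card, Fintype.card_subtype,
    zero_mul, sub_zero]
  refine tier_step x hx hκ.le hR ?_ ?_ hre'
  · intro i hi
    simp only [Finset.mem_filter, Finset.mem_univ, true_and, not_forall, exists_prop] at hi
    obtain ⟨j, hd, hg⟩ := hi
    exact ⟨j, Finset.mem_filter.2 ⟨Finset.mem_univ _, hg⟩, by rwa [dist_comm]⟩
  · intro i hi hiΩ
    exact Finset.mem_filter.2 ⟨Finset.mem_univ _, (Finset.mem_filter.1 hiΩ).2, (Finset.mem_filter.1 hi).2⟩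

end Summit.AtomisticToContinuum.Crystallization.Theorems.ElasticTierOverlapSplit

namespace Summit.AtomisticToContinuum.Crystallization.Theorems

open Literature.MathematicalPhysics.StatisticalMechanics Literature.Geometry.DiscreteGeometry

/-- **Registered stub `stub_elasticTierGlue` of line `elastic-tier-overlap-split`** (crux `StarCoercivity`,
stmt-AtomisticToContinuum-13600; skeleton reshape r2): the regional elastic engine implies the near tier S2, verbatim the
registered signature — a restatement of `ElasticTierOverlapSplit.elasticTier_of_regionalEngine` as an implication. -/
theorem stub_elasticTierGlue :
    (∃ κ : ℝ, 0 < κ ∧ ∃ R Cf : ℝ, 0 ≤ R ∧ ∀ (N : ℕ) (x : Fin N → EuclideanSpace ℝ (Fin 3)),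
    (∀ i j : Fin N, i ≠ j → (1 / 3 : ℝ) ≤ dist (x i) (x j)) →
    κ * ((Finset.univ.filter fun i : Fin N =>
            (∀ j : Fin N, dist (x j) (x i) ≤ R → ∃ a : ℝ, 9 / 10 ≤ a ∧ a ≤ 11 / 10 ∧
              (ShellCloseTo (1 / 15) ((Finset.univ.filter fun k : Fin N => k ≠ j ∧ dist (x j) (x k) ≤ 6 / 5).image
                  fun k => a⁻¹ • (x k - x j)) fccKissingPattern ∨
                ShellCloseTo (1 / 15) ((Finset.univ.filter fun k : Fin N => k ≠ j ∧ dist (x j) (x k) ≤ 6 / 5).image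
                  fun k => a⁻¹ • (x k - x j)) hcpKissingPattern)) ∧
            ¬ ∃ a : ℝ, 9 / 10 ≤ a ∧ a ≤ 11 / 10 ∧
              (ShellCloseTo (1 / 20) ((Finset.univ.filter fun j : Fin N => j ≠ i ∧ dist (x i) (x j) ≤ 6 / 5).image
                  fun j => a⁻¹ • (x j - x i)) fccKissingPattern ∨
                ShellCloseTo (1 / 20) ((Finset.univ.filter fun j : Fin N => j ≠ i ∧ dist (x i) (x j) ≤ 6 / 5).image
                  fun j => a⁻¹ • (x j - x i)) hcpKissingPattern)).card : ℝ)
        - Cf * (Nat.card {i : Fin N // ¬ ∃ a : ℝ, 9 / 10 ≤ a ∧ a ≤ 11 / 10 ∧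
            (ShellCloseTo (1 / 15) ((Finset.univ.filter fun j : Fin N => j ≠ i ∧ dist (x i) (x j) ≤ 6 / 5).image
                fun j => a⁻¹ • (x j - x i)) fccKissingPattern ∨
              ShellCloseTo (1 / 15) ((Finset.univ.filter fun j : Fin N => j ≠ i ∧ dist (x i) (x j) ≤ 6 / 5).image
                fun j => a⁻¹ • (x j - x i)) hcpKissingPattern)} : ℝ)
      ≤ ∑ i ∈ Finset.univ.filter (fun i : Fin N => ∀ j : Fin N, dist (x j) (x i) ≤ R →
            ∃ a : ℝ, 9 / 10 ≤ a ∧ a ≤ 11 / 10 ∧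
              (ShellCloseTo (1 / 15) ((Finset.univ.filter fun k : Fin N => k ≠ j ∧ dist (x j) (x k) ≤ 6 / 5).image
                  fun k => a⁻¹ • (x k - x j)) fccKissingPattern ∨
                ShellCloseTo (1 / 15) ((Finset.univ.filter fun k : Fin N => k ≠ j ∧ dist (x j) (x k) ≤ 6 / 5).image
                  fun k => a⁻¹ • (x k - x j)) hcpKissingPattern)),
          ((1 / 2 : ℝ) * (∑ j ∈ Finset.univ.erase i, lennardJones (dist (x i) (x j)))
            - ⨅ Q : PeriodicConfiguration 3, Q.energyPerParticle lennardJones)) →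
    ∃ κ : ℝ, 0 < κ ∧ ∃ Cb C : ℝ, ∀ (N : ℕ) (x : Fin N → EuclideanSpace ℝ (Fin 3)),
      (∀ i j : Fin N, i ≠ j → (1 / 3 : ℝ) ≤ dist (x i) (x j)) →
      (N : ℝ) * (⨅ Q : PeriodicConfiguration 3, Q.energyPerParticle lennardJones)
          + κ * (Nat.card {i : Fin N // ¬ ∃ a : ℝ, 9 / 10 ≤ a ∧ a ≤ 11 / 10 ∧
              (ShellCloseTo (1 / 20) ((Finset.univ.filter fun j : Fin N => j ≠ i ∧ dist (x i) (x j) ≤ 6 / 5).image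
                  fun j => a⁻¹ • (x j - x i)) fccKissingPattern ∨
                ShellCloseTo (1 / 20) ((Finset.univ.filter fun j : Fin N => j ≠ i ∧ dist (x i) (x j) ≤ 6 / 5).image
                  fun j => a⁻¹ • (x j - x i)) hcpKissingPattern)} : ℝ)
          - Cb * (Nat.card {i : Fin N // ¬ ∃ a : ℝ, 9 / 10 ≤ a ∧ a ≤ 11 / 10 ∧
              (ShellCloseTo (1 / 15) ((Finset.univ.filter fun j : Fin N => j ≠ i ∧ dist (x i) (x j) ≤ 6 / 5).image
                  fun j => a⁻¹ • (x j - x i)) fccKissingPattern ∨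
                ShellCloseTo (1 / 15) ((Finset.univ.filter fun j : Fin N => j ≠ i ∧ dist (x i) (x j) ≤ 6 / 5).image
                  fun j => a⁻¹ • (x j - x i)) hcpKissingPattern)} : ℝ)
          - C * (N : ℝ) ^ (2 / 3 : ℝ) ≤ interactionEnergy lennardJones x :=
  fun h => ElasticTierOverlapSplit.elasticTier_of_regionalEngine h

end Summit.AtomisticToContinuum.Crystallization.Theorems

end
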